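import Literature.NumberTheory.EllipticCurves.MazurRubin2015.KummerImageTwistedAboveP
import Literature.NumberTheory.EllipticCurves.LFunctionPrimeCoeff
import Summits.BirchSwinnertonDyer.Rank1Residual.Supersingular.X7VisibilityWitnessShape
import HarnessLib

/-!
# Crux `GordTwoRankZeroOffCaseOne` (item 19357): the SELMER-COMPANION / VISIBILITY door at the
# ADDITIVE prime — `ord_p #Ш(E)_an ≤ ord_p #Ш(E)` on cell (G-ord, `e = 2`) ∩ `r_an = 0` from a
# `p`-congruent partner and ONE named rational point, the place `p` itself being FREE by
# Mazur–Rubin 2015 Thm. 3.1 for the twist `χ = χ_{p*}` (NO engine value, NO main conjecture)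

Cell `bsd-addord`, seat `bsd-addord-k1-c2` (D-0074 row B1), gen 4. HONEST FRAMING: nothing here proves
the Birch–Swinnerton-Dyer conjecture or the crux; THEOREMS ONLY (no definition, no named fact, no
`sorry`); every published input is an explicit named-fact binder; every per-pair input (the
`p`-congruence `θ`, the witness point, the finite set of places and their kinds, the twist models, the
datum `#Ш_an`) is a displayed binder decided OUTSIDE this file (kernel deciders exist for each, see
the per-pair records `Supersingular/X7VisibilityWitnessFiveRecords*.lean` of cell `b2b-bsdres`); nothing
is booked by this file.

## The observation (gen 4)

On the cell `E ≅ V^{(p*)}` with `V` GOOD (ordinary) at `p`, `p* = (−1)^{(p−1)/2} p`. Mazur–Rubin,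
*Selmer companion curves* (Trans. AMS 367 (2015)) Thm. 3.1 concludes `Sel_p(E₁^χ/F) = Sel_p(E₂^χ/F)`
for EVERY quadratic character `χ` — in particular the RAMIFIED `χ_{p*}` — from hypotheses on the
UNTWISTED curves `E₁ = V`, `E₂ = V'` (good at `p`, `k = 1`, `e(𝔭/p) < p − 1`): at the additive place `p`
of `E = V^{(p*)}` and of a `p`-congruent partner `E' = V'^{(p*)}` the local Kummer conditions AGREE (§6
Case 5, twisted paragraph: `image(κ_{E_i^χ/ℚ_p}) = image(κ_{E_i/L})⁻`, `L = ℚ_p(√p*)`, + Raynaud). That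
paragraph is the named fact `MazurRubin2015.selmerLocalKer_iff_of_twist_of_goodReduction_above`
(`Literature/…/MazurRubin2015/KummerImageTwistedAboveP.lean`, this seat), the twisted sibling of the
tree's `selmerLocalKer_iff_of_goodReduction_above` (kind (v) of the b2b visibility certificate). With
it the place `p` becomes a SIXTH free kind — "(vi) `w ∣ p`, both curves `p*`-twists of curves good at
`p`" — in team b2b's WITNESS ROAD (`Supersingular/X7VisibilityWitnessShape.lean`: Cremona–Mazur's
original form of visibility, `VisibleWitness.exists_sha_ne_zero_of_congr_of_witness` of team n1011):
NAME a point `P ∈ E'(ℚ) ∖ pE'(ℚ)` whose transported Kummer class is Selmer for `E` at every bad place;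
then `Ш(E)[p] ≠ 0`, Cassels–Tate squareness gives `p² ∣ #Ш(E)`, hence `ord_p #Ш(E)_an ≤ ord_p #Ш(E)`
whenever `ord_p #Ш(E)_an ≤ 2` — the crux's conclusion `MissingLowerBoundAt W p` AT THE PAIR, for EVERY
odd `p` (`p = 3` included: `e(ℚ₃/ℚ₃) = 1 < 2`), with NO Iwasawa theory, NO `p`-adic `L`-value, NO
Kato / EPW / GV / Delbourgo binder on the lower side. Compared with gen 3's Route-G doors
(`…GordTwoRankZeroIrreducible.lean`: budget / rank-`≥ λ` partner + ONE ENGINE VALUE `CERT(E)@b`), this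
door (a) needs no engine value at all (every binder is exact, decidable data), and (b) does not see
`λ`: the pure-Ш rows whose clean rank-2 partner has `λ(E₁) = λ(E) > 2` (engine A: `2900d1 ~ 2900c1`
`λ = 8`; `10850m1`, `40850d1`, `63350d1`, `254100di1`, `336400cn1` `λ = 6`; nine rows `λ = 4`), OPEN for
every Iwasawa road, are ordinary clients here.

## What (class-free; `W` = the target, `W'` = the partner; the cell's DOORS are in the sibling file
## `AdditiveBranchIMCGordTwoRankZeroCompanionDoors.lean`)

* §0 the named fact over `ℚ` with prime-indexed good reduction of the untwisted models (bridge
  `hasGoodReductionAtPrime_iff_hasGoodReductionAt_ringOfIntegers`; ramification automatic).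
* §1 local dispatch at a place `w ∈ S` for the transported Kummer class of a rational point `P ∈ W'(ℚ)`:
  (a) `P` has a `p`-th root in `W'(ℚ_w)`; (i) `w ∤ p`, `W'(ℚ_w)[p] = 0`; (ii) both split multiplicative,
  `#W(ℚ_w)[p] ≤ p` (Tate, `hU`); (iii) both multiplicative of the same `γ`-class, `μ_p(ℚ_w) = 1` (`hU2`);
  (iv) one non-split multiplicative, the other good (Fisher 2016 Thm. 4.4, `hF44`); **(vi) `w ∣ p`** — free
  by the twist models `C • V^{(d)} = W`, `C' • V'^{(d)} = W'`, `V`, `V'` good at `p` (`hMRt`); and the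
  LEAN variant (a)/(i)/(vi) conditional on `hMRt` alone.
* §2 `Ш(W)[p] ≠ 0` from a named witness (`W(ℚ)` finite of order prime to `p`), six-option and lean forms.

HONEST PRICE. The door bites on a pair only if a `p`-congruent curve of positive rank with compatible
bad places exists (per-pair search + certificate, EVIDENCE, outside the kernel: `E[p] ≅ E'[p]` by
Kraus–Oesterlé / Fisher's Hesse pencil at `p = 5`; the witness by a reduction certificate; local
`p`-torsion counts by the kernel decider); it does not reach the pure-Ш rows without a partner in range,
nor says anything class-wide: the crux stays OPEN.

References: Mazur–Rubin 2015 Thm. 3.1, §6 Case 5 [MazurRubin2015SelmerCompanions]; Cremona–Mazur 2000 §3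
[CremonaMazur2000]; Agashe–Stein 2002 Lemma 3.6 [AgasheStein2002]; Fisher 2016 Thm. 4.4
[Fisher2016Visualizing7]; Silverman ATAEC V.3.1/V.5.3 [SilvermanATAEC1994]; Silverman AEC X.4.14
[SilvermanAEC2009]; Kato 2004 Thm. 17.4 [Kato2004Asterisque]; Delbourgo 1998 Prop. 4 [Delbourgo1998];
Pal 2012 Thm. 3.2 [Pal2012]; Miller 2011 Def. 1.1 [Miller2011LMS]; Mazur 1977 III.§5 [Mazur1977].
-/

set_option autoImplicit false

noncomputable section

open scoped Classical

open WeierstrassCurve Literature.NumberTheory.EllipticCurves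
  Literature.NumberTheory.EllipticCurves.Rank1Residual
  Literature.NumberTheory.EllipticCurves.Rank1Residual.Typed
  Literature.NumberTheory.EllipticCurves.Wuthrich2014
  Literature.NumberTheory.EllipticCurves.Fisher2016
  Literature.NumberTheory.EllipticCurves.MazurRubin2015
  Literature.NumberTheory.GaloisRepresentations
  Summit.BirchSwinnertonDyer.Rank1Residual.GaloisImage
open NumberField IsDedekindDomain Rat.HeightOneSpectrum Field
  Literature.NumberTheory.EllipticCurves.ModularForms

set_option linter.dupNamespace false

namespace Summit.BirchSwinnertonDyer.BirchSwinnertonDyer.Theorems.AdditiveBranchIMCGordTwoRankZeroCompanion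

open Summit.BirchSwinnertonDyer.Rank1Residual
open Summit.BirchSwinnertonDyer.Rank1Residual.Additive

/-! ## §0 The named fact over `ℚ`, prime-indexed good reduction of the untwisted models -/

section Fact

variable {W W' : WeierstrassCurve ℚ} [W.IsElliptic] [W'.IsElliptic] {p : ℕ} [hp : Fact p.Prime]

/-- **Mazur–Rubin 2015 at the place of `p` over `ℚ`, prime-indexed form.** For an odd prime `p`, twists
`W = C • V^{(d)}`, `W' = C' • V'^{(d)}` (same `d ≠ 0`) of curves `V`, `V'` with GOOD reduction at `p`
(`HasGoodReductionAtPrime p`), a `Γ_ℚ`-isomorphism `θ : W'[p] ⥲ W[p]` and the place `v` of `p`: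
`θ_* 𝓢_v(W') ≤ 𝓢_v(W)`. The ramification clause of the fact is automatic (`e = 1 < p − 1`,
`Fisher2016.ramificationIdx_int_rat_eq_one`); bridge `hasGoodReductionAtPrime_iff_hasGoodReductionAt_ringOfIntegers`
(`primesEquiv v = p`). Conditional on the named fact `hMRt`.
[cite: MazurRubin2015SelmerCompanions, Thm. 3.1 and §6 proof Case 5 (twisted paragraph)] -/
theorem selmerLocalKer_le_of_twist_of_hasGoodReductionAtPrime
    (hMRt : selmerLocalKer_iff_of_twist_of_goodReduction_above) (hp2 : p ≠ 2)
    (V V' : WeierstrassCurve ℚ) [V.IsElliptic] [V'.IsElliptic]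
    {d : ℚ} (C C' : VariableChange ℚ) (hd : d ≠ 0)
    (hW : C • V.quadraticTwist d = W) (hW' : C' • V'.quadraticTwist d = W')
    (θ : geomTorsion W' (p : ℤ) ≃+ geomTorsion W (p : ℤ))
    (hθ : ∀ (σ : absoluteGaloisGroup ℚ) (P : geomTorsion W' (p : ℤ)), θ (σ • P) = σ • θ P)
    (v : HeightOneSpectrum (𝓞 ℚ)) (hv : (p : 𝓞 ℚ) ∈ v.asIdeal)
    (hV : V.HasGoodReductionAtPrime p) (hV' : V'.HasGoodReductionAtPrime p)
    {c : galH1Torsion W' (p : ℤ)} (hc : c ∈ selmerLocalKer W' (v.adicCompletion ℚ) (p : ℤ)) :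
    h1Equiv θ hθ c ∈ selmerLocalKer W (v.adicCompletion ℚ) (p : ℤ) := by
  have hpv : (primesEquiv v : ℕ) = p := primesEquiv_eq_of_natCast_mem v hp.out hv
  have hgood : ∀ U : WeierstrassCurve ℚ, U.HasGoodReductionAtPrime p → U.HasGoodReductionAt v := by
    intro U hU
    refine (U.hasGoodReductionAtPrime_iff_hasGoodReductionAt_ringOfIntegers (v := v)).mp ?_
    have hF : Fact (primesEquiv v : ℕ).Prime := Fact.mk (by rw [hpv]; exact hp.out)
    convert hU
  have hram : v.asIdeal.ramificationIdx ℤ < p - 1 := by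
    have h1 := ramificationIdx_int_rat_eq_one v
    have h3 : 3 ≤ p := by
      rcases hp.out.eq_two_or_odd' with h | h
      · exact absurd h hp2
      · have := hp.out.two_le; omega
    omega
  exact (hMRt W W' V V' p hp2 d C C' hd hW hW' θ hθ v hv hram (hgood V hV) (hgood V' hV') c).mp hc

end Fact

/-! ## §1 Local dispatch for the transported Kummer class of a rational point of the partner -/

section Witness

variable {W W' : WeierstrassCurve ℚ} [W.IsElliptic] [W'.IsElliptic] {p : ℕ} [hp : Fact p.Prime]

/-- Local dispatch (six options, the place `p` by the TWIST MODELS): at a place `w ∈ S`, the transported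
Kummer class `θ_* κ'(P)` of `P ∈ W'(ℚ)` satisfies the local condition of `W` if EITHER (a) `P|_{ℚ_w}` has a
`p`-th root in `W'(ℚ_w)` OR `w` is of one of the free kinds (i) `w ∤ p`, `W'(ℚ_w)[p] = 0`; (ii) both split
multiplicative, `#W(ℚ_w)[p] ≤ p`; (iii) both multiplicative of the same `γ`-class, `μ_p(ℚ_w) = 1`; (iv) one
non-split multiplicative, the other good; **(vi) `w ∣ p`**, where `W = C • V^{(d)}`, `W' = C' • V'^{(d)}` with
`V`, `V'` GOOD at `p` (Mazur–Rubin 2015 for the twist `χ_d`, `hMRt`). Dispatch to the tree's comparison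
lemmas verbatim as in `Supersingular.h1Equiv_kummerMapTorsion_mem_selmerLocalKer_of_witness₆`, kind (v)
(both curves good at `p`, impossible for a twist by `p*`) replaced by (vi). Conditional on `hU`, `hU2`
(kinds (ii)/(iii)), `hF44` (kind (iv)), `hMRt` (kind (vi)).
[cite: MazurRubin2015SelmerCompanions, Thm. 3.1 and §6 Case 5 (twisted paragraph)]
[cite: Fisher2016Visualizing7, Thm. 4.4 (p. 106)] [cite: CremonaMazur2000, §3] [cite: SilvermanATAEC1994, Ch. V Thm. 3.1, Thm. 5.3] -/
theorem h1Equiv_kummerMapTorsion_mem_selmerLocalKer_of_witness_twist₆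
    (hU : Silverman1994_thmV53_tateUniformisation.{0})
    (hU2 : Silverman1994_thmV53_corV54_tateUniformisation.{0})
    (hF44 : thm44_selmerLocalKer_iff_of_nonsplit_good)
    (hMRt : selmerLocalKer_iff_of_twist_of_goodReduction_above)
    (hp2 : p ≠ 2) (θ : geomTorsion W' (p : ℤ) ≃+ geomTorsion W (p : ℤ))
    (hθ : ∀ (σ : absoluteGaloisGroup ℚ) (P : geomTorsion W' (p : ℤ)), θ (σ • P) = σ • θ P)
    (V V' : WeierstrassCurve ℚ) [V.IsElliptic] [V'.IsElliptic]
    {d : ℚ} (C C' : VariableChange ℚ) (hd : d ≠ 0)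
    (hWV : C • V.quadraticTwist d = W) (hWV' : C' • V'.quadraticTwist d = W')
    (hV : V.HasGoodReductionAtPrime p) (hV' : V'.HasGoodReductionAtPrime p)
    (hdiv' : ∀ Q : geomPoints W', ∃ R : geomPoints W', (p : ℤ) • R = Q) (P : W'.toAffine.Point)
    (w : HeightOneSpectrum (𝓞 ℚ))
    (hw : (∃ Q : (W'.baseChange (w.adicCompletion ℚ)).toAffine.Point,
        p • Q = WeierstrassCurve.Affine.Point.baseChange (W' := W') ℚ (w.adicCompletion ℚ) P) ∨
      ((p : 𝓞 ℚ) ∉ w.asIdeal ∧ Nat.card (nsmulAddMonoidHom p :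
          (W'.baseChange (w.adicCompletion ℚ)).toAffine.Point →+ _).ker = 1) ∨
      (W.HasSplitMultiplicativeReductionAt w ∧ W'.HasSplitMultiplicativeReductionAt w ∧
        Nat.card (nsmulAddMonoidHom p :
          (W.baseChange (w.adicCompletion ℚ)).toAffine.Point →+ _).ker ≤ p) ∨
      (W.HasMultiplicativeReductionAt w ∧ W'.HasMultiplicativeReductionAt w ∧
        (∃ r : w.adicCompletion ℚ, algebraMap ℚ (w.adicCompletion ℚ) (-(W.c₄ / W.c₆)) =
          r ^ 2 * algebraMap ℚ (w.adicCompletion ℚ) (-(W'.c₄ / W'.c₆))) ∧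
        (∀ ζ : w.adicCompletion ℚ, ζ ^ p = 1 → ζ = 1)) ∨
      ((W.HasMultiplicativeReductionAt w ∧ ¬ W.HasSplitMultiplicativeReductionAt w ∧
          W'.HasGoodReductionAt w) ∨
        (W.HasGoodReductionAt w ∧ W'.HasMultiplicativeReductionAt w ∧
          ¬ W'.HasSplitMultiplicativeReductionAt w)) ∨
      ((p : 𝓞 ℚ) ∈ w.asIdeal)) :
    h1Equiv θ hθ (kummerMapTorsion W' (p : ℤ) hdiv' P) ∈ selmerLocalKer W (w.adicCompletion ℚ) (p : ℤ) := by
  have hpp : p.Prime := hp.out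
  have hn : (p : ℤ) ≠ 0 := by exact_mod_cast hpp.ne_zero
  have hram : w.asIdeal.ramificationIdx ℤ < p - 1 := by
    have h1 := ramificationIdx_int_rat_eq_one w
    have h3 : 3 ≤ p := by
      rcases hpp.eq_two_or_odd' with h' | h'
      · exact absurd h' hp2
      · have := hpp.two_le; omega
    omega
  -- the Kummer class of a rational point is Selmer for `W'` everywhere
  have hc : kummerMapTorsion W' (p : ℤ) hdiv' P ∈ selmerLocalKer W' (w.adicCompletion ℚ) (p : ℤ) :=
    kummerMapTorsion_mem_selmerLocalKer W' _ hdiv' _ P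
  rcases hw with ⟨Q, hQ⟩ | ⟨hwp, hloc⟩ | ⟨hWw, hW'w, hcardw⟩ | ⟨hWw, hW'w, hγw, hμw⟩ | hkind | hwp
  · -- (a): a `p`-th root of `P` in `W'(ℚ_w)` — the class restricts to zero at `w`
    exact VisibleWitness.h1Equiv_kummerMapTorsion_mem_selmerLocalKer_of_exists_smul_eq W W' θ hθ
      (w.adicCompletion ℚ) hn hdiv' P ⟨Q, by rw [natCast_zsmul]; exact hQ⟩
  · -- kind (i): `w ∤ p`, `W'(ℚ_w)[p] = 0`
    exact (relIndex_map_selmerLocalKer_eq_one_iff W W' θ hθ).mp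
      (relIndex_map_selmerLocalKer_eq_one_of_card_torsion_eq_one W W' θ hθ hwp hloc) _ hc
  · -- kind (ii): both split multiplicative, `#W(ℚ_w)[p] ≤ p` (Tate uniformisation)
    exact W.h1Equiv_mem_selmerLocalKer_of_hasSplitMultiplicativeReductionAt w hU W' θ hθ hWw hW'w hcardw hc
  · -- kind (iii): both multiplicative of the same `γ`-class, `μ_p(ℚ_w) = 1`
    exact W.h1Equiv_mem_selmerLocalKer_of_hasMultiplicativeReductionAt w hU2 hp2 W' θ hθ hWw hW'w hγw hμw
      hc
  · -- kind (iv): one non-split multiplicative, the other good (Fisher 2016 Thm. 4.4)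
    exact selmerLocalKer_le_of_nonsplit_good W hF44 hp2 W' θ hθ w (Or.inr hram) hkind hc
  · -- kind (vi): `w ∣ p`, both curves twists by `d` of curves GOOD at `p` (Mazur–Rubin 2015, twisted)
    exact selmerLocalKer_le_of_twist_of_hasGoodReductionAtPrime hMRt hp2 V V' C C' hd hWV hWV' θ hθ w hwp
      hV hV' hc

/-- Local dispatch, LEAN variant (three options; conditional on `hMRt` alone — no Tate uniformisation, no
Fisher 2016): (a) a `p`-th root of `P` in `W'(ℚ_w)`, OR (i) `w ∤ p ∧ W'(ℚ_w)[p] = 0`, OR (vi) `w ∣ p` (the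
twist models). On the cell's rows every bad place `w ≠ p` of an additive partner is of kind (i) for
`p ≥ 5` (`E'(ℚ_w)/E'_0` has order `≤ 4`, `E'_0/E'_1 ≅ 𝔽_w`, `E'_1` pro-`w`: Mazur–Rubin Lemma 5.1 (ii)),
decided per pair by the kernel's local-torsion decider.
[cite: MazurRubin2015SelmerCompanions, Thm. 3.1, §6 Case 5 (twisted paragraph) and Lemma 5.1 (ii)] [cite: CremonaMazur2000, §3] -/
theorem h1Equiv_kummerMapTorsion_mem_selmerLocalKer_of_witness_twist
    (hMRt : selmerLocalKer_iff_of_twist_of_goodReduction_above)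
    (hp2 : p ≠ 2) (θ : geomTorsion W' (p : ℤ) ≃+ geomTorsion W (p : ℤ))
    (hθ : ∀ (σ : absoluteGaloisGroup ℚ) (P : geomTorsion W' (p : ℤ)), θ (σ • P) = σ • θ P)
    (V V' : WeierstrassCurve ℚ) [V.IsElliptic] [V'.IsElliptic]
    {d : ℚ} (C C' : VariableChange ℚ) (hd : d ≠ 0)
    (hWV : C • V.quadraticTwist d = W) (hWV' : C' • V'.quadraticTwist d = W')
    (hV : V.HasGoodReductionAtPrime p) (hV' : V'.HasGoodReductionAtPrime p)
    (hdiv' : ∀ Q : geomPoints W', ∃ R : geomPoints W', (p : ℤ) • R = Q) (P : W'.toAffine.Point)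
    (w : HeightOneSpectrum (𝓞 ℚ))
    (hw : (∃ Q : (W'.baseChange (w.adicCompletion ℚ)).toAffine.Point,
        p • Q = WeierstrassCurve.Affine.Point.baseChange (W' := W') ℚ (w.adicCompletion ℚ) P) ∨
      ((p : 𝓞 ℚ) ∉ w.asIdeal ∧ Nat.card (nsmulAddMonoidHom p :
          (W'.baseChange (w.adicCompletion ℚ)).toAffine.Point →+ _).ker = 1) ∨
      ((p : 𝓞 ℚ) ∈ w.asIdeal)) :
    h1Equiv θ hθ (kummerMapTorsion W' (p : ℤ) hdiv' P) ∈ selmerLocalKer W (w.adicCompletion ℚ) (p : ℤ) := by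
  have hpp : p.Prime := hp.out
  have hn : (p : ℤ) ≠ 0 := by exact_mod_cast hpp.ne_zero
  have hc : kummerMapTorsion W' (p : ℤ) hdiv' P ∈ selmerLocalKer W' (w.adicCompletion ℚ) (p : ℤ) :=
    kummerMapTorsion_mem_selmerLocalKer W' _ hdiv' _ P
  rcases hw with ⟨Q, hQ⟩ | ⟨hwp, hloc⟩ | hwp
  · exact VisibleWitness.h1Equiv_kummerMapTorsion_mem_selmerLocalKer_of_exists_smul_eq W W' θ hθ
      (w.adicCompletion ℚ) hn hdiv' P ⟨Q, by rw [natCast_zsmul]; exact hQ⟩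
  · exact (relIndex_map_selmerLocalKer_eq_one_iff W W' θ hθ).mp
      (relIndex_map_selmerLocalKer_eq_one_of_card_torsion_eq_one W W' θ hθ hwp hloc) _ hc
  · exact selmerLocalKer_le_of_twist_of_hasGoodReductionAtPrime hMRt hp2 V V' C C' hd hWV hWV' θ hθ w hwp
      hV hV' hc

/-! ## §2 The visible element of `Ш(W)[p]` from a named witness -/

/-- **The visible element of `Ш(E/ℚ)[p]` from a NAMED witness, twisted place `p`** (any `W/ℚ` with
`E(ℚ)` finite of order prime to `p` that is a twist `C • V^{(d)}` of a curve good at `p`, the partner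
`W' = C' • V'^{(d)}` likewise): `θ : W'[p] ⥲ W[p]` a `Γ_ℚ`-isomorphism, `S` a finite set of places off which
both curves are good and `w ∤ p`, `P ∈ W'(ℚ) ∖ pW'(ℚ)`, and at every `w ∈ S` one of the six options of
`h1Equiv_kummerMapTorsion_mem_selmerLocalKer_of_witness_twist₆`. Then `Ш(E/ℚ)` has a non-zero element
killed by `p` (n1011-p09's `VisibleWitness.exists_sha_ne_zero_of_congr_of_witness`).
[cite: CremonaMazur2000, §3] [cite: AgasheStein2002, Lemma 3.6] [cite: MazurRubin2015SelmerCompanions, Thm. 3.1] -/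
theorem exists_sha_ne_zero_of_congr_of_witness_twist₆
    (hU : Silverman1994_thmV53_tateUniformisation.{0})
    (hU2 : Silverman1994_thmV53_corV54_tateUniformisation.{0})
    (hF44 : thm44_selmerLocalKer_iff_of_nonsplit_good)
    (hMRt : selmerLocalKer_iff_of_twist_of_goodReduction_above)
    (hp2 : p ≠ 2) (θ : geomTorsion W' (p : ℤ) ≃+ geomTorsion W (p : ℤ))
    (hθ : ∀ (σ : absoluteGaloisGroup ℚ) (P : geomTorsion W' (p : ℤ)), θ (σ • P) = σ • θ P)
    (V V' : WeierstrassCurve ℚ) [V.IsElliptic] [V'.IsElliptic]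
    {d : ℚ} (C C' : VariableChange ℚ) (hd : d ≠ 0)
    (hWV : C • V.quadraticTwist d = W) (hWV' : C' • V'.quadraticTwist d = W')
    (hV : V.HasGoodReductionAtPrime p) (hV' : V'.HasGoodReductionAtPrime p)
    (S : Finset (HeightOneSpectrum (𝓞 ℚ)))
    (hS : ∀ w : HeightOneSpectrum (𝓞 ℚ), w ∉ S →
      W.HasGoodReductionAt w ∧ W'.HasGoodReductionAt w ∧ (p : 𝓞 ℚ) ∉ w.asIdeal)
    (hfin : Finite W.toAffine.Point) (hcop : (Nat.card W.toAffine.Point).Coprime p)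
    (P : W'.toAffine.Point)
    (hP : P ∉ (zsmulAddGroupHom (p : ℤ) : W'.toAffine.Point →+ W'.toAffine.Point).range)
    (hplaces : ∀ w ∈ S,
      (∃ Q : (W'.baseChange (w.adicCompletion ℚ)).toAffine.Point,
        p • Q = WeierstrassCurve.Affine.Point.baseChange (W' := W') ℚ (w.adicCompletion ℚ) P) ∨
      ((p : 𝓞 ℚ) ∉ w.asIdeal ∧ Nat.card (nsmulAddMonoidHom p :
          (W'.baseChange (w.adicCompletion ℚ)).toAffine.Point →+ _).ker = 1) ∨
      (W.HasSplitMultiplicativeReductionAt w ∧ W'.HasSplitMultiplicativeReductionAt w ∧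
        Nat.card (nsmulAddMonoidHom p :
          (W.baseChange (w.adicCompletion ℚ)).toAffine.Point →+ _).ker ≤ p) ∨
      (W.HasMultiplicativeReductionAt w ∧ W'.HasMultiplicativeReductionAt w ∧
        (∃ r : w.adicCompletion ℚ, algebraMap ℚ (w.adicCompletion ℚ) (-(W.c₄ / W.c₆)) =
          r ^ 2 * algebraMap ℚ (w.adicCompletion ℚ) (-(W'.c₄ / W'.c₆))) ∧
        (∀ ζ : w.adicCompletion ℚ, ζ ^ p = 1 → ζ = 1)) ∨
      ((W.HasMultiplicativeReductionAt w ∧ ¬ W.HasSplitMultiplicativeReductionAt w ∧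
          W'.HasGoodReductionAt w) ∨
        (W.HasGoodReductionAt w ∧ W'.HasMultiplicativeReductionAt w ∧
          ¬ W'.HasSplitMultiplicativeReductionAt w)) ∨
      ((p : 𝓞 ℚ) ∈ w.asIdeal)) :
    ∃ c : W.sha, c ≠ 0 ∧ p • c = 0 := by
  have hpp : p.Prime := hp.out
  have hn : (p : ℤ) ≠ 0 := by exact_mod_cast hpp.ne_zero
  haveI := hfin
  have hdiv' : ∀ Q : geomPoints W', ∃ R : geomPoints W', (p : ℤ) • R = Q :=
    W'.zsmul_geomPoints_surjective_holds hn
  have hE : (zsmulAddGroupHom (p : ℤ) : W.toAffine.Point →+ W.toAffine.Point).range = ⊤ := by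
    rw [← AddSubgroup.index_eq_one]
    exact index_range_zsmul_eq_one_of_coprime hcop
  -- the tree's witness theorem is stated for a general number field with the classical `DecidableEq`; over
  -- `ℚ` the binders here carry `instDecidableEqRat` (the instances are equal, `Subsingleton`): `convert`.
  exact VisibleWitness.exists_sha_ne_zero_of_congr_of_witness W W' hp2 θ hθ S hS hdiv' (by convert hE) P
    (by convert hP) fun w hw ↦
    h1Equiv_kummerMapTorsion_mem_selmerLocalKer_of_witness_twist₆ hU hU2 hF44 hMRt hp2 θ hθ V V' C C' hd
      hWV hWV' hV hV' hdiv' P w (hplaces w hw)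

/-- **The visible element of `Ш(E/ℚ)[p]` from a NAMED witness, twisted place `p`, lean variant** (options
(a) / (i) / (vi) only; conditional on `hMRt` alone).
[cite: CremonaMazur2000, §3] [cite: AgasheStein2002, Lemma 3.6] [cite: MazurRubin2015SelmerCompanions, Thm. 3.1] -/
theorem exists_sha_ne_zero_of_congr_of_witness_twist
    (hMRt : selmerLocalKer_iff_of_twist_of_goodReduction_above)
    (hp2 : p ≠ 2) (θ : geomTorsion W' (p : ℤ) ≃+ geomTorsion W (p : ℤ))
    (hθ : ∀ (σ : absoluteGaloisGroup ℚ) (P : geomTorsion W' (p : ℤ)), θ (σ • P) = σ • θ P)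
    (V V' : WeierstrassCurve ℚ) [V.IsElliptic] [V'.IsElliptic]
    {d : ℚ} (C C' : VariableChange ℚ) (hd : d ≠ 0)
    (hWV : C • V.quadraticTwist d = W) (hWV' : C' • V'.quadraticTwist d = W')
    (hV : V.HasGoodReductionAtPrime p) (hV' : V'.HasGoodReductionAtPrime p)
    (S : Finset (HeightOneSpectrum (𝓞 ℚ)))
    (hS : ∀ w : HeightOneSpectrum (𝓞 ℚ), w ∉ S →
      W.HasGoodReductionAt w ∧ W'.HasGoodReductionAt w ∧ (p : 𝓞 ℚ) ∉ w.asIdeal)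
    (hfin : Finite W.toAffine.Point) (hcop : (Nat.card W.toAffine.Point).Coprime p)
    (P : W'.toAffine.Point)
    (hP : P ∉ (zsmulAddGroupHom (p : ℤ) : W'.toAffine.Point →+ W'.toAffine.Point).range)
    (hplaces : ∀ w ∈ S,
      (∃ Q : (W'.baseChange (w.adicCompletion ℚ)).toAffine.Point,
        p • Q = WeierstrassCurve.Affine.Point.baseChange (W' := W') ℚ (w.adicCompletion ℚ) P) ∨
      ((p : 𝓞 ℚ) ∉ w.asIdeal ∧ Nat.card (nsmulAddMonoidHom p :
          (W'.baseChange (w.adicCompletion ℚ)).toAffine.Point →+ _).ker = 1) ∨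
      ((p : 𝓞 ℚ) ∈ w.asIdeal)) :
    ∃ c : W.sha, c ≠ 0 ∧ p • c = 0 := by
  have hpp : p.Prime := hp.out
  have hn : (p : ℤ) ≠ 0 := by exact_mod_cast hpp.ne_zero
  haveI := hfin
  have hdiv' : ∀ Q : geomPoints W', ∃ R : geomPoints W', (p : ℤ) • R = Q :=
    W'.zsmul_geomPoints_surjective_holds hn
  have hE : (zsmulAddGroupHom (p : ℤ) : W.toAffine.Point →+ W.toAffine.Point).range = ⊤ := by
    rw [← AddSubgroup.index_eq_one]
    exact index_range_zsmul_eq_one_of_coprime hcop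
  exact VisibleWitness.exists_sha_ne_zero_of_congr_of_witness W W' hp2 θ hθ S hS hdiv' (by convert hE) P
    (by convert hP) fun w hw ↦
    h1Equiv_kummerMapTorsion_mem_selmerLocalKer_of_witness_twist hMRt hp2 θ hθ V V' C C' hd hWV hWV' hV
      hV' hdiv' P w (hplaces w hw)

end Witness

end Summit.BirchSwinnertonDyer.BirchSwinnertonDyer.Theorems.AdditiveBranchIMCGordTwoRankZeroCompanion

end
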